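import Summits.HodgeConjecture.HodgeConjecture.Cruxes.BlochSeedDiscOne.IntegralityGap

/-!
# BlochSeedDiscOne — strengthen lens g10: the TEST-FORM ∕ PRODUCT COVERING calculus of `μ` (support rigidity)

D-0145 token: `line stmt-HodgeConjecture-18881 Cruxes/BlochSeedDiscOne/Lines/birth.lean 814a6a70c14e831a stub_rung_pad4_seedAt`.
HONEST FRAMING. Planner workfile (lens «strengthen», unit `plan-lens-HodgeAV-strengthen-g10`). NOTHING here is proved toward
HC ∕ HC_CM ∕ HC_AV ∕ №4 ∕ 26512 ∕ 18881 ∕ H2; this is letter-level linear algebra on the class-tensor model of `DepthBoundA4.lean`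
(Letter, Cell, Design, Sym, Word, cellCoef, `Design.T`, `μ = T eeee`, (A1), (A4)) — evidence and typed files, not rungs.
No `sorry`, no axiom, no `instance`, no notation, no `native_decide`; imports `IntegralityGap` (→ `DepthBoundA4`) only — §0 re-declares the
weighted-sum bookkeeping of `HeightTower` §0 byte-for-byte (the farm does not build `HeightTower` as an import target).

THE CALCULUS (memo STRENGTHEN-MEMO-14). A TEST FORM is a function `λ : Word → ℤ[i]`; its pairing with the class tensor is
`Σ_w λ_w·T(w) = T(Σ_w λ_w·cellCoef(·,w))` (linearity, §1). If `λ` is BLIND TO THE CLEAN SUBSPACE — `λ(ēēēē) = 0` and, for every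
degree `d`, `Σ_{w e-free, deg w = d} λ_w = 0` — then under (A1) the pairing equals `λ(eeee)·μ`; if moreover the cell function
`c ↦ Σ_w λ_w·cellCoef c w` VANISHES ON THE SUPPORT, the pairing is `0`, so `λ(eeee)·μ = 0` (**TEST-FORM THEOREM**, `testForm_mu`,
§2). A support admitting such a `λ` with `λ(eeee) ≠ 0` is μ-RIGID: `μ = 0` for EVERY choice of signs and masses on it; by linear
duality a support is NON-rigid iff it carries a COMPLEX-weighted (A1)-clean combination with `μ ≠ 0`. The sign-blind candidate S⁺
RIGID(h,s) = `AllRigid` («every (A4)-admissible support with `≤ s` cells is rigid») formally implies `IntegralityGap.SparseNonex`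
and `Nonex 14 199 8` (§2b) — and is REFUTED in §8 at `(14, 97)`: the whole content of the crux-side nonexistence is in the SIGNS
(positivity of masses and the (A4) coupling of signs to geometry), which no test-form law sees.
PRODUCT TEST FORMS (§3, the PHASE-TORUS shape): `λ_w = Π_f φ_f(w_f)` for letter functionals `φ_f = c1 + ca·a + ce·β̄ + cE·β + cn·n`;
then `Σ_w λ_w cellCoef c w = Π_f φ_f(c_f)` (`evalProd_expand`), and blindness holds as soon as SOME factor functional lies in
`span(β̄, β)` (kills every e-free word) and SOME factor functional has no `β` term (kills `ēēēē`). **COVERING LAW** (`coveringLaw`):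
if in addition `Π_f ce_f ≠ 0` and EVERY SUPPORT CELL HAS A FACTOR `f` WITH `φ_f(c_f) = 0`, then `μ = 0` — cell-wise over factors,
for all signs ∕ masses. The one-factor case (one `φ_f` kills all letters used on factor `f`, `φ_g = β̄` elsewhere) is the LETTER-SPAN
LAW of `LetterSpanLaw.lean` (negation lens g3, class-level model) restated for `Design` (`oneFactorLaw`, §4) — cited, not claimed.
COROLLARIES (§4–§6, all signs ∕ masses, any height): PLANE LAW (`planeLaw`: the letters used on a factor satisfy one affine relation
`p + q·a + r·x + s·y = 0` with `(r, s) ≠ (0, 0)` ⇒ `μ = 0`); VERTICAL-PLANE LAW (`collinearBetaLaw`: the `β`'s used on a factor are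
collinear ⇒ `μ = 0`); QUADRANT LAW on the alphabet `A_η` (`quadrantLaw`: on some factor all letters used lie in ONE CLOSED QUADRANT
⇒ `μ = 0`, since there `a + σx + τy = η`); the TAME-CONE LEMMA (`fstQuadrant_of_ample_tame`: for `x₀, y₀ > 0` with
`x₀y₀ ≤ 2x₀ + y₀` and `x₀y₀ ≤ x₀ + 2y₀` every letter of `A_η` amply above `(a₀; x₀, y₀)` has `x, y ≥ 0`) and the **TAME-FACTOR
LAW** (`tameFactorLaw`: an (A1) ∧ (A4) design on `A_η` whose P-letters on some factor are all tame first-quadrant letters has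
`μ = 0`; tame = `(1,k), (k,1), (2,k≤4), (k≤4,2), (3,3)` — in particular EVERY off-axis letter of co-level `≤ 6`; by the reflections
`x ↦ −x`, `y ↦ −y` the same holds in each open quadrant (§7): **RING-SIX MONOCHROME LAW** `ringSix_monochromeLaw` — if on some factor
all P-letters lie in ONE open quadrant and have co-level `≤ 6`, then `μ = 0`; so a `μ ≠ 0` (A4) design whose P-letters have
co-level `≤ 6` is POLYCHROME: its P-letters meet `≥ 2` open quadrants on EVERY factor — budget-free, sign-free, at every height).
LIMITS (said plainly, and proved): every law here is a SIGN-BLIND support law, so (i) none of them can prove the floors `8 … 14` of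
the height tower (`HeightTower.nonex_14_iff_floors`), which are rationally FALSE (MEMO-12/13 designs), and (ii) their joint reach is
bounded by the **PYTHAGOREAN SIGNED SEED** (§8, `py_identity`): the three level-7 letters `(7;3,4), (7;4,3), (7;−3,4)` of the ring
`|β| = 5` synthesise `δ_e` on one factor (`Σ_j U_j·coef s ℓ_j = 12·[s = e]`, `U = (1+7i, −6i, −1−i)`), so the 81 cells `{ℓ₁,ℓ₂,ℓ₃}⁴`
with weights `Π_f U` have class tensor `12⁴·δ_eeee` EXACTLY — a complex-weighted (A1)-clean `μ ≠ 0` combination on 81 cells (its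
real part is a real SIGNED one on 75 cells with `T = 12⁴(δ_eeee + δ_ēēēē)`); padded by the 16 companion P-cells `{(4;5,5),(4;−5,5)}⁴`
it is an (A4)-admissible support of 97 cells, whence `not_allRigid_14_97 : ¬ AllRigid 14 97` and `¬ AllRigid 14 199`; the same
synthesis with three HUB NEIGHBOURS `(h−1;1,0), (h−1;0,1), (h−1;−1,0)` (`4U = (1−i, 2i, −1−i)`) and companions `(h−4;±2,2)` refutes
RIGID(h, 97) INSIDE RINGS ≤ 4 at EVERY height `h ≥ 4` (`not_allRigid_hub`) — where actual designs ARE excluded by the budgeted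
positivity certificates `RingFourEmpty` ∕ `RingFiveEmpty`. So the S⁺ sought by the brief cannot be a sign-blind letter calculus; the sign-aware linear calculus (LP duality) is refuted on floors `≥ 8` by
the rational witnesses; what remains is integrality-aware (cutting-plane ∕ branching certificates), for which no letter-finite form
is known. The laws above stay valid necessary conditions (floors 6–7, P-letter geometry).
-/

set_option linter.dupNamespace false
set_option autoImplicit false

namespace Summit.HodgeConjecture.HodgeConjecture.Cruxes.BlochSeedDiscOne.CoveringLaw

open Summit.HodgeConjecture.HodgeConjecture.Cruxes.BlochSeedDiscOne.DepthBoundA4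
open Summit.HodgeConjecture.HodgeConjecture.Cruxes.BlochSeedDiscOne.IntegralityGap
open Finset

/-! ## §0 Weighted sums and `T` as a linear functional (verbatim `HeightTower` §0) -/

/-- `Σ m·u(c)` over a list of (cell, multiplicity) entries. -/
def wsum (L : List (Cell × ℕ)) (u : Cell → GaussianInt) : GaussianInt :=
  (L.map fun cm => (cm.2 : GaussianInt) * u cm.1).sum

theorem wsum_add (L : List (Cell × ℕ)) (u v : Cell → GaussianInt) :
    wsum L (fun c => u c + v c) = wsum L u + wsum L v := by
  induction L with
  | nil => simp [wsum]
  | cons a t ih =>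
    simp only [wsum, List.map_cons, List.sum_cons] at ih ⊢
    rw [ih]; ring

theorem wsum_smul (L : List (Cell × ℕ)) (r : GaussianInt) (u : Cell → GaussianInt) :
    wsum L (fun c => r * u c) = r * wsum L u := by
  induction L with
  | nil => simp [wsum]
  | cons a t ih =>
    simp only [wsum, List.map_cons, List.sum_cons] at ih ⊢
    rw [ih]; ring

/-- `T` as a linear functional of the cell-coefficient function. -/
def Tf (D : Design) (u : Cell → GaussianInt) : GaussianInt := wsum D.N u - wsum D.P u

theorem T_eq_Tf (D : Design) (w : Word) : D.T w = Tf D (fun c => cellCoef c w) := rfl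

theorem Tf_add (D : Design) (u v : Cell → GaussianInt) : Tf D (fun c => u c + v c) = Tf D u + Tf D v := by
  unfold Tf; rw [wsum_add, wsum_add]; ring

theorem Tf_smul (D : Design) (r : GaussianInt) (u : Cell → GaussianInt) : Tf D (fun c => r * u c) = r * Tf D u := by
  unfold Tf; rw [wsum_smul, wsum_smul]; ring

theorem Tf_congr (D : Design) {u v : Cell → GaussianInt} (h : ∀ c, u c = v c) : Tf D u = Tf D v := by
  have : u = v := funext h
  rw [this]

/-! ## §1 Bookkeeping: sums over `Sym`, linearity of `T`, vanishing on the support -/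

theorem univ_sym : (Finset.univ : Finset Sym) = {Sym.one, Sym.h, Sym.e, Sym.ebar, Sym.pt} := by
  ext s
  simp only [Finset.mem_univ, Finset.mem_insert, Finset.mem_singleton, true_iff]
  cases s <;> simp

theorem sum_sym {M : Type*} [AddCommMonoid M] (g : Sym → M) :
    ∑ s : Sym, g s = g Sym.one + g Sym.h + g Sym.e + g Sym.ebar + g Sym.pt := by
  rw [univ_sym]
  simp [Finset.sum_insert, add_assoc]

/-- Boolean (decidable) e-freeness of a word; `efreeB w = true ↔ w.efree`. -/
def efreeB (w : Word) : Bool := (w 0).efree && (w 1).efree && (w 2).efree && (w 3).efree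

theorem efreeB_iff (w : Word) : efreeB w = true ↔ w.efree := by
  unfold efreeB Word.efree
  simp only [Bool.and_eq_true]
  constructor
  · rintro ⟨⟨⟨h0, h1⟩, h2⟩, h3⟩ f
    fin_cases f
    · exact h0
    · exact h1
    · exact h2
    · exact h3
  · intro h; exact ⟨⟨⟨h 0, h 1⟩, h 2⟩, h 3⟩

theorem efreeB_eeee : efreeB Word.eeee = false := by decide
theorem efreeB_EEEE : efreeB Word.EEEE = false := by decide

theorem wsum_zero (L : List (Cell × ℕ)) : wsum L (fun _ => 0) = 0 := by
  induction L with
  | nil => simp [wsum]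
  | cons a t ih =>
    simp only [wsum, List.map_cons, List.sum_cons, mul_zero, zero_add] at ih ⊢
    exact ih

theorem Tf_zero (D : Design) : Tf D (fun _ => 0) = 0 := by
  unfold Tf; rw [wsum_zero, wsum_zero, sub_zero]

theorem Tf_finset_sum {ι : Type*} [DecidableEq ι] (D : Design) (s : Finset ι) (u : ι → Cell → GaussianInt) :
    Tf D (fun c => ∑ i ∈ s, u i c) = ∑ i ∈ s, Tf D (u i) := by
  induction s using Finset.induction_on with
  | empty => simpa using Tf_zero D
  | insert a s ha ih =>
    rw [Finset.sum_insert ha, ← ih, ← Tf_add]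
    exact Tf_congr D (fun c => by rw [Finset.sum_insert ha])

/-- A weighted sum whose weight function vanishes on every entry of positive multiplicity is `0`. -/
theorem wsum_eq_zero_of_pos (L : List (Cell × ℕ)) (u : Cell → GaussianInt)
    (h : ∀ cm ∈ L, 0 < cm.2 → u cm.1 = 0) : wsum L u = 0 := by
  induction L with
  | nil => simp [wsum]
  | cons a t ih =>
    have ht : wsum t u = 0 := ih (fun cm hcm hpos => h cm (List.mem_cons_of_mem a hcm) hpos)
    simp only [wsum, List.map_cons, List.sum_cons] at ht ⊢
    rw [ht, add_zero]
    by_cases ha : 0 < a.2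
    · rw [h a List.mem_cons_self ha, mul_zero]
    · have : a.2 = 0 := by omega
      rw [this]; simp

/-- `T` of a cell function vanishing on the support is `0`. -/
theorem Tf_eq_zero_of_supp (D : Design) (u : Cell → GaussianInt)
    (h : ∀ c ∈ D.suppN ++ D.suppP, u c = 0) : Tf D u = 0 := by
  have hN : wsum D.N u = 0 := by
    refine wsum_eq_zero_of_pos D.N u ?_
    rintro ⟨c, m⟩ hcm hpos
    exact h c (List.mem_append.2 (Or.inl ((mem_suppN_iff D c).2 ⟨m, hcm, hpos⟩)))
  have hP : wsum D.P u = 0 := by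
    refine wsum_eq_zero_of_pos D.P u ?_
    rintro ⟨c, m⟩ hcm hpos
    exact h c (List.mem_append.2 (Or.inr ((mem_suppP_iff D c).2 ⟨m, hcm, hpos⟩)))
  unfold Tf; rw [hN, hP, sub_zero]

/-! ## §2 The TEST-FORM THEOREM -/

/-- The pairing of a test form `λ` with the class tensor is `T` of the cell function `c ↦ Σ_w λ_w · cellCoef c w`. -/
theorem pairing_eq_Tf (D : Design) (lam : Word → GaussianInt) :
    ∑ w : Word, lam w * D.T w = Tf D (fun c => ∑ w : Word, lam w * cellCoef c w) := by
  rw [Tf_finset_sum]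
  refine Finset.sum_congr rfl (fun w _ => ?_)
  rw [Tf_smul, T_eq_Tf]

/-- An e-free representative word of each degree `d ≤ 8`. -/
def rep : ℕ → Word
  | 0 => ![Sym.one, Sym.one, Sym.one, Sym.one]
  | 1 => ![Sym.h, Sym.one, Sym.one, Sym.one]
  | 2 => ![Sym.h, Sym.h, Sym.one, Sym.one]
  | 3 => ![Sym.h, Sym.h, Sym.h, Sym.one]
  | 4 => ![Sym.h, Sym.h, Sym.h, Sym.h]
  | 5 => ![Sym.pt, Sym.h, Sym.h, Sym.h]
  | 6 => ![Sym.pt, Sym.pt, Sym.h, Sym.h]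
  | 7 => ![Sym.pt, Sym.pt, Sym.pt, Sym.h]
  | _ => ![Sym.pt, Sym.pt, Sym.pt, Sym.pt]

theorem rep_efree_deg {d : ℕ} (hd : d ≤ 8) : (rep d).efree ∧ (rep d).deg = d := by
  interval_cases d <;> exact ⟨fun f => by fin_cases f <;> decide, by decide⟩

theorem sym_deg_le_two (s : Sym) : s.deg ≤ 2 := by cases s <;> decide

theorem deg_le_eight (w : Word) : w.deg ≤ 8 := by
  unfold Word.deg
  calc ∑ f : Fin 4, (w f).deg ≤ ∑ _f : Fin 4, 2 := Finset.sum_le_sum (fun f _ => sym_deg_le_two (w f))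
    _ = 8 := by simp

theorem not_efree_eeee : ¬ Word.eeee.efree := fun h => by simpa [Word.eeee, Sym.efree] using h 0

theorem not_efree_EEEE : ¬ Word.EEEE.efree := fun h => by simpa [Word.EEEE, Sym.efree] using h 0

/-- Under (A1) the e-MIXED part of the pairing of a test form with `λ(ēēēē) = 0` is `λ(eeee)·μ`. -/
theorem pairing_mixed (D : Design) (h1 : D.A1) (lam : Word → GaussianInt) (hE : lam Word.EEEE = 0) :
    ∑ w ∈ Finset.univ.filter (fun w : Word => ¬ efreeB w = true), lam w * D.T w = lam Word.eeee * D.mu := by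
  rw [Finset.sum_eq_single_of_mem Word.eeee (Finset.mem_filter.2 ⟨Finset.mem_univ _, by rw [efreeB_eeee]; decide⟩)]
  · rfl
  · intro w hw hne
    have hw' : ¬ w.efree := fun h => (Finset.mem_filter.1 hw).2 ((efreeB_iff w).2 h)
    by_cases hE' : w = Word.EEEE
    · rw [hE', hE, zero_mul]
    · rw [h1.1 w hw' hne hE', mul_zero]

/-- Under (A1) the e-FREE part of the pairing of a test form whose degree-class sums vanish is `0`. -/
theorem pairing_efree (D : Design) (h1 : D.A1) (lam : Word → GaussianInt)
    (hdeg : ∀ d ∈ Finset.range 9, ∑ w ∈ Finset.univ.filter (fun w : Word => efreeB w = true ∧ w.deg = d), lam w = 0) :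
    ∑ w ∈ Finset.univ.filter (fun w : Word => efreeB w = true), lam w * D.T w = 0 := by
  set F := Finset.univ.filter (fun w : Word => efreeB w = true) with hF
  have hmaps : ∀ w ∈ F, w.deg ∈ Finset.range 9 := fun w _ => Finset.mem_range.2 (by have := deg_le_eight w; omega)
  calc ∑ w ∈ F, lam w * D.T w = ∑ w ∈ F, lam w * D.T (rep w.deg) := by
        refine Finset.sum_congr rfl (fun w hw => ?_)
        have hw' : w.efree := (efreeB_iff w).1 (Finset.mem_filter.1 hw).2
        rw [h1.2 w (rep w.deg) hw' (rep_efree_deg (deg_le_eight w)).1 (rep_efree_deg (deg_le_eight w)).2.symm]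
    _ = ∑ d ∈ Finset.range 9, ∑ w ∈ F.filter (fun w => w.deg = d), lam w * D.T (rep w.deg) :=
        (Finset.sum_fiberwise_of_maps_to hmaps _).symm
    _ = ∑ d ∈ Finset.range 9, (∑ w ∈ F.filter (fun w => w.deg = d), lam w) * D.T (rep d) := by
        refine Finset.sum_congr rfl (fun d _ => ?_)
        rw [Finset.sum_mul]
        refine Finset.sum_congr rfl (fun w hw => ?_)
        rw [(Finset.mem_filter.1 hw).2]
    _ = 0 := by
        refine Finset.sum_eq_zero (fun d hd => ?_)
        have : F.filter (fun w => w.deg = d) = Finset.univ.filter (fun w : Word => efreeB w = true ∧ w.deg = d) := by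
          rw [hF, Finset.filter_filter]
        rw [this, hdeg d hd, zero_mul]

/-- **TEST-FORM THEOREM.** For an (A1)-clean design and a test form `λ : Word → ℤ[i]` that is blind to the clean subspace
(`λ(ēēēē) = 0`, every degree-class sum over e-free words vanishes) and whose cell function `c ↦ Σ_w λ_w·cellCoef c w` vanishes on the
support, `λ(eeee) · μ = 0`. (So a support carrying such a `λ` with `λ(eeee) ≠ 0` is μ-rigid: `μ = 0` for all signs and masses.) -/
theorem testForm_mu (D : Design) (h1 : D.A1) (lam : Word → GaussianInt)
    (hE : lam Word.EEEE = 0)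
    (hdeg : ∀ d ∈ Finset.range 9, ∑ w ∈ Finset.univ.filter (fun w : Word => efreeB w = true ∧ w.deg = d), lam w = 0)
    (hsupp : ∀ c ∈ D.suppN ++ D.suppP, ∑ w : Word, lam w * cellCoef c w = 0) :
    lam Word.eeee * D.mu = 0 := by
  have h0 : ∑ w : Word, lam w * D.T w = 0 := by
    rw [pairing_eq_Tf]; exact Tf_eq_zero_of_supp D _ hsupp
  rw [← Finset.sum_filter_add_sum_filter_not Finset.univ (fun w : Word => efreeB w = true), pairing_efree D h1 lam hdeg,
    pairing_mixed D h1 lam hE, zero_add] at h0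
  exact h0

/-- μ-RIGIDITY of a cell list: there is a test form blind to the clean subspace, vanishing on the list, with `λ(eeee) ≠ 0`
(scale-free form; over `ℚ(i)` one may normalise `λ(eeee) = 1`). -/
def Rigid (S : List Cell) : Prop :=
  ∃ lam : Word → GaussianInt, lam Word.eeee ≠ 0 ∧ lam Word.EEEE = 0 ∧
    (∀ d ∈ Finset.range 9, ∑ w ∈ Finset.univ.filter (fun w : Word => efreeB w = true ∧ w.deg = d), lam w = 0) ∧
    (∀ c ∈ S, ∑ w : Word, lam w * cellCoef c w = 0)

/-- A design supported on a rigid cell list has `μ = 0` (any signs, any masses). -/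
theorem mu_eq_zero_of_rigid (D : Design) (h1 : D.A1) (S : List Cell) (hS : Rigid S)
    (hsub : ∀ c ∈ D.suppN ++ D.suppP, c ∈ S) : D.mu = 0 := by
  obtain ⟨lam, he, hE, hdeg, hv⟩ := hS
  have := testForm_mu D h1 lam hE hdeg (fun c hc => hv c (hsub c hc))
  rcases mul_eq_zero.1 this with h | h
  · exact absurd h he
  · exact h

/-- Rigidity is hereditary: sub-lists of rigid lists are rigid (so the obstructions are the MINIMAL non-rigid lists). -/
theorem rigid_mono {S S' : List Cell} (h : ∀ c ∈ S', c ∈ S) (hS : Rigid S) : Rigid S' := by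
  obtain ⟨lam, he, hE, hdeg, hv⟩ := hS
  exact ⟨lam, he, hE, hdeg, fun c hc => hv c (h c hc)⟩

/-- **RIGID(h, s)** — the sign-blind S⁺ candidate of MEMO-14: every support of an (A4) design on the height-`h` alphabet with `≤ s`
cells is μ-rigid. (Antitone in `s`; a statement about SUPPORTS only — no signs, masses, budget or rank. REFUTED at `(14, 97)` in §8;
kept as the formal frame `AllRigid ⇒ SparseNonex ⇒ Nonex`.) -/
def AllRigid (h : ℤ) (s : ℕ) : Prop :=
  ∀ D : Design, D.OnAlphabet h → D.A4 → (D.suppN ++ D.suppP).length ≤ s → Rigid (D.suppN ++ D.suppP)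

theorem allRigid_mono {h : ℤ} {s s' : ℕ} (hs : s' ≤ s) (H : AllRigid h s) : AllRigid h s' :=
  fun D hA h4 hl => H D hA h4 (le_trans hl hs)

/-- RIGID(h, s) ⇒ SPARSE-NONEX(h, s; B, rmin) for every budget and rank (`IntegralityGap.SparseNonex`, ledger row #81). -/
theorem sparseNonex_of_allRigid {h : ℤ} {s : ℕ} (H : AllRigid h s) (B : ℕ) (rmin : ℤ) : SparseNonex h s B rmin :=
  fun D hA h1 h4 hμ hl _ => hμ (mu_eq_zero_of_rigid D h1 _ (H D hA h4 hl) (fun _ hc => hc))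

/-- In particular RIGID(14, 199) ⇒ NONEX(14, 199, 8) (an integer design with `≤ 199` copies has `≤ 199` support cells). -/
theorem nonex_of_allRigid (H : AllRigid 14 199) : Nonex 14 199 8 :=
  nonex_of_sparse (sparseNonex_of_allRigid H 199 8)

/-! ## §3 PRODUCT test forms and the COVERING LAW -/

/-- A letter functional, given by its five weights: `φ(ℓ) = Σ_s φ s · coef s ℓ = φ₁ + φ_h·a + φ_e·β̄ + φ_ē·β + φ_pt·n`. -/
abbrev LFun : Type := Sym → GaussianInt

/-- Evaluation of a letter functional on a letter. -/
def eval (φ : LFun) (ℓ : Letter) : GaussianInt := ∑ s : Sym, φ s * s.coef ℓ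

theorem eval_eq (φ : LFun) (ℓ : Letter) : eval φ ℓ =
    φ Sym.one + φ Sym.h * (ℓ.a : GaussianInt) + φ Sym.e * star ℓ.beta + φ Sym.ebar * ℓ.beta
      + φ Sym.pt * (ℓ.selfInt : GaussianInt) := by
  rw [eval, sum_sym]; simp [Sym.coef]

/-- The product functional of four letter functionals, evaluated on a cell. -/
def evalProd (Φ : Fin 4 → LFun) (c : Cell) : GaussianInt := ∏ f : Fin 4, eval (Φ f) (c f)

/-- The product test form `λ_w = Π_f φ_f(w_f)`. -/
def lamProd (Φ : Fin 4 → LFun) (w : Word) : GaussianInt := ∏ f : Fin 4, Φ f (w f)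

/-- Multilinear expansion: `Π_f φ_f(c_f) = Σ_w (Π_f φ_f(w_f)) · cellCoef c w`. -/
theorem evalProd_expand (Φ : Fin 4 → LFun) (c : Cell) :
    evalProd Φ c = ∑ w : Word, lamProd Φ w * cellCoef c w := by
  unfold evalProd eval lamProd cellCoef
  rw [Fintype.prod_sum (fun f s => Φ f s * s.coef (c f))]
  refine Finset.sum_congr rfl (fun w _ => ?_)
  rw [Finset.prod_mul_distrib]

theorem lamProd_eeee (Φ : Fin 4 → LFun) : lamProd Φ Word.eeee = ∏ f : Fin 4, Φ f Sym.e := rfl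

theorem lamProd_EEEE (Φ : Fin 4 → LFun) : lamProd Φ Word.EEEE = ∏ f : Fin 4, Φ f Sym.ebar := rfl

/-- **COVERING LAW** (PHASE-TORUS shape, cell-wise over factors; all signs, all masses). Let `φ₀ … φ₃` be letter functionals with
(a) some `φ_{f₁} ∈ span(β̄, β)` (no `1, a, n` terms), (b) some `φ_{f₂}` without `β` term, (c) `Π_f (β̄-weight of φ_f) ≠ 0`, and
(d) every support cell `c` has a factor `f` with `φ_f(c_f) = 0`. Then an (A1)-clean design has `μ = 0`. -/
theorem coveringLaw (D : Design) (h1 : D.A1) (Φ : Fin 4 → LFun)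
    (ha : ∃ f₁ : Fin 4, Φ f₁ Sym.one = 0 ∧ Φ f₁ Sym.h = 0 ∧ Φ f₁ Sym.pt = 0)
    (hb : ∃ f₂ : Fin 4, Φ f₂ Sym.ebar = 0)
    (hc : ∏ f : Fin 4, Φ f Sym.e ≠ 0)
    (hd : ∀ c ∈ D.suppN ++ D.suppP, ∃ f : Fin 4, eval (Φ f) (c f) = 0) : D.mu = 0 := by
  obtain ⟨f₁, h1one, h1h, h1pt⟩ := ha
  obtain ⟨f₂, h2⟩ := hb
  have hE : lamProd Φ Word.EEEE = 0 := by
    rw [lamProd_EEEE]; exact Finset.prod_eq_zero (Finset.mem_univ f₂) h2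
  have hfree : ∀ w : Word, w.efree → lamProd Φ w = 0 := by
    intro w hw
    unfold lamProd
    refine Finset.prod_eq_zero (Finset.mem_univ f₁) ?_
    have hs := hw f₁
    revert hs
    cases w f₁ <;> simp [Sym.efree, h1one, h1h, h1pt]
  have hdeg : ∀ d ∈ Finset.range 9,
      ∑ w ∈ Finset.univ.filter (fun w : Word => efreeB w = true ∧ w.deg = d), lamProd Φ w = 0 := by
    intro d _
    exact Finset.sum_eq_zero (fun w hw => hfree w ((efreeB_iff w).1 (Finset.mem_filter.1 hw).2.1))
  have hsupp : ∀ c ∈ D.suppN ++ D.suppP, ∑ w : Word, lamProd Φ w * cellCoef c w = 0 := by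
    intro c hc
    rw [← evalProd_expand]
    obtain ⟨f, hf⟩ := hd c hc
    exact Finset.prod_eq_zero (Finset.mem_univ f) hf
  have := testForm_mu D h1 (lamProd Φ) hE hdeg hsupp
  rw [lamProd_eeee] at this
  rcases mul_eq_zero.1 this with h | h
  · exact absurd h hc
  · exact h

/-- Covered cell lists are rigid (the covering as a test form, normalised by `(Π ce)⁻¹` is not available in `ℤ[i]`, so we record the
un-normalised statement: the product form is blind and vanishes on the list). -/
theorem covering_testForm (Φ : Fin 4 → LFun)
    (ha : ∃ f₁ : Fin 4, Φ f₁ Sym.one = 0 ∧ Φ f₁ Sym.h = 0 ∧ Φ f₁ Sym.pt = 0)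
    (hb : ∃ f₂ : Fin 4, Φ f₂ Sym.ebar = 0) (S : List Cell)
    (hd : ∀ c ∈ S, ∃ f : Fin 4, eval (Φ f) (c f) = 0) :
    lamProd Φ Word.EEEE = 0 ∧
    (∀ d ∈ Finset.range 9, ∑ w ∈ Finset.univ.filter (fun w : Word => efreeB w = true ∧ w.deg = d), lamProd Φ w = 0) ∧
    (∀ c ∈ S, ∑ w : Word, lamProd Φ w * cellCoef c w = 0) := by
  obtain ⟨f₁, h1one, h1h, h1pt⟩ := ha
  obtain ⟨f₂, h2⟩ := hb
  refine ⟨?_, ?_, ?_⟩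
  · rw [lamProd_EEEE]; exact Finset.prod_eq_zero (Finset.mem_univ f₂) h2
  · intro d _
    refine Finset.sum_eq_zero (fun w hw => ?_)
    have hw' : w.efree := (efreeB_iff w).1 (Finset.mem_filter.1 hw).2.1
    unfold lamProd
    refine Finset.prod_eq_zero (Finset.mem_univ f₁) ?_
    have hs := hw' f₁
    revert hs
    cases w f₁ <;> simp [Sym.efree, h1one, h1h, h1pt]
  · intro c hc
    rw [← evalProd_expand]
    obtain ⟨f, hf⟩ := hd c hc
    exact Finset.prod_eq_zero (Finset.mem_univ f) hf

/-- Covered lists are rigid: the finite letter calculus that certifies RIGID. -/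
theorem rigid_of_covering (S : List Cell) (Φ : Fin 4 → LFun)
    (ha : ∃ f₁ : Fin 4, Φ f₁ Sym.one = 0 ∧ Φ f₁ Sym.h = 0 ∧ Φ f₁ Sym.pt = 0)
    (hb : ∃ f₂ : Fin 4, Φ f₂ Sym.ebar = 0) (hc : ∏ f : Fin 4, Φ f Sym.e ≠ 0)
    (hd : ∀ c ∈ S, ∃ f : Fin 4, eval (Φ f) (c f) = 0) : Rigid S := by
  obtain ⟨hE, hdeg, hv⟩ := covering_testForm Φ ha hb S hd
  exact ⟨lamProd Φ, by rw [lamProd_eeee]; exact hc, hE, hdeg, hv⟩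

/-! ## §4 ONE-FACTOR LAW (= LETTER-SPAN LAW of `LetterSpanLaw.lean`, restated for `Design`) and the PLANE LAWS -/

/-- The functional `β̄` (the symbol `e`). -/
def phiE : LFun := fun s => if s = Sym.e then 1 else 0

theorem phiE_e : phiE Sym.e = 1 := by simp [phiE]
theorem phiE_ebar : phiE Sym.ebar = 0 := by simp [phiE]
theorem phiE_one : phiE Sym.one = 0 := by simp [phiE]
theorem phiE_h : phiE Sym.h = 0 := by simp [phiE]
theorem phiE_pt : phiE Sym.pt = 0 := by simp [phiE]

/-- **ONE-FACTOR LAW** (LETTER-SPAN LAW, negation g3, for `Design`): if one letter functional with `β̄`-weight `≠ 0` kills every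
letter used on factor `f`, then `μ = 0` (all signs, all masses). -/
theorem oneFactorLaw (D : Design) (h1 : D.A1) (f : Fin 4) (φ : LFun) (hφ : φ Sym.e ≠ 0)
    (hkill : ∀ c ∈ D.suppN ++ D.suppP, eval φ (c f) = 0) : D.mu = 0 := by
  obtain ⟨g, hg⟩ : ∃ g : Fin 4, g ≠ f := by
    by_cases h0 : f = 0
    · exact ⟨1, by rw [h0]; decide⟩
    · exact ⟨0, fun h => h0 h.symm⟩
  let Φ : Fin 4 → LFun := Function.update (fun _ => phiE) f φ
  have hΦf : Φ f = φ := by simp [Φ]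
  have hΦg : ∀ g' : Fin 4, g' ≠ f → Φ g' = phiE := fun g' hg' => by simp [Φ, hg']
  refine coveringLaw D h1 Φ ⟨g, ?_, ?_, ?_⟩ ⟨g, ?_⟩ ?_ ?_
  · rw [hΦg g hg, phiE_one]
  · rw [hΦg g hg, phiE_h]
  · rw [hΦg g hg, phiE_pt]
  · rw [hΦg g hg, phiE_ebar]
  · rw [← Finset.mul_prod_erase Finset.univ (fun g' => Φ g' Sym.e) (Finset.mem_univ f), hΦf]
    refine mul_ne_zero hφ ?_
    rw [Finset.prod_eq_one]
    · exact one_ne_zero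
    · intro g' hg'
      rw [hΦg g' (Finset.ne_of_mem_erase hg'), phiE_e]
  · intro c hc
    exact ⟨f, by rw [hΦf]; exact hkill c hc⟩

/-- The plane functional `2p + 2q·a + (r + is)·β̄ + (r − is)·β` = `2(p + q a + r x + s y)` on letters. -/
def phiPlane (p q r s : ℤ) : LFun := fun sy =>
  match sy with
  | Sym.one => ((2 * p : ℤ) : GaussianInt)
  | Sym.h => ((2 * q : ℤ) : GaussianInt)
  | Sym.e => ⟨r, s⟩
  | Sym.ebar => ⟨r, -s⟩
  | Sym.pt => 0

theorem eval_phiPlane (p q r s : ℤ) (ℓ : Letter) :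
    eval (phiPlane p q r s) ℓ = ((2 * (p + q * ℓ.a + r * ℓ.x + s * ℓ.y) : ℤ) : GaussianInt) := by
  rw [eval_eq]
  rw [Zsqrtd.ext_iff]
  simp [phiPlane, Letter.beta, Zsqrtd.re_mul, Zsqrtd.im_mul]
  constructor <;> ring

/-- **PLANE LAW.** If the letters used on factor `f` satisfy one affine relation `p + q·a + r·x + s·y = 0` with `(r, s) ≠ (0, 0)`
(they lie on a plane of `(a, x, y)`-space that is not horizontal), then `μ = 0`. Three letters not all on one level are always
coplanar in this sense; so a `μ ≠ 0` support uses, on every factor, `≥ 4` letters in general position or `≥ 3` on one level. -/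
theorem planeLaw (D : Design) (h1 : D.A1) (f : Fin 4) (p q r s : ℤ) (hrs : r ≠ 0 ∨ s ≠ 0)
    (hrel : ∀ c ∈ D.suppN ++ D.suppP, p + q * (c f).a + r * (c f).x + s * (c f).y = 0) : D.mu = 0 := by
  refine oneFactorLaw D h1 f (phiPlane p q r s) ?_ ?_
  · intro h0
    have hre := congrArg Zsqrtd.re h0
    have him := congrArg Zsqrtd.im h0
    simp [phiPlane] at hre him
    rcases hrs with h | h
    · exact h hre
    · exact h him
  · intro c hc
    rw [eval_phiPlane, hrel c hc, mul_zero, Int.cast_zero]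

/-- **VERTICAL-PLANE LAW.** If the `β`'s used on factor `f` all lie on one affine line `r·x + s·y = t`, `(r, s) ≠ (0, 0)` — e.g. at
most two distinct `β` values, or all on one axis ray — then `μ = 0`. -/
theorem collinearBetaLaw (D : Design) (h1 : D.A1) (f : Fin 4) (r s t : ℤ) (hrs : r ≠ 0 ∨ s ≠ 0)
    (hrel : ∀ c ∈ D.suppN ++ D.suppP, r * (c f).x + s * (c f).y = t) : D.mu = 0 :=
  planeLaw D h1 f (-t) 0 r s hrs (fun c hc => by have := hrel c hc; linarith)

/-- TWO-β LAW: if the letters used on factor `f` take at most two `β`-values, then `μ = 0`. -/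
theorem twoBetaLaw (D : Design) (h1 : D.A1) (f : Fin 4) (x₁ y₁ x₂ y₂ : ℤ)
    (hβ : ∀ c ∈ D.suppN ++ D.suppP, ((c f).x = x₁ ∧ (c f).y = y₁) ∨ ((c f).x = x₂ ∧ (c f).y = y₂)) : D.mu = 0 := by
  by_cases heq : x₁ = x₂ ∧ y₁ = y₂
  · refine collinearBetaLaw D h1 f 1 0 x₁ (Or.inl one_ne_zero) (fun c hc => ?_)
    rcases hβ c hc with ⟨hx, _⟩ | ⟨hx, _⟩
    · rw [hx]; ring
    · rw [hx, ← heq.1]; ring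
  · have hrs : y₂ - y₁ ≠ 0 ∨ x₁ - x₂ ≠ 0 := by
      by_contra hcon
      push Not at hcon
      exact heq ⟨by omega, by omega⟩
    refine collinearBetaLaw D h1 f (y₂ - y₁) (x₁ - x₂) (x₁ * y₂ - x₂ * y₁) hrs (fun c hc => ?_)
    rcases hβ c hc with ⟨hx, hy⟩ | ⟨hx, hy⟩
    · rw [hx, hy]; ring
    · rw [hx, hy]; ring

/-- ONE-AXIS LAW (cf. `LetterSpanLaw.wch_eWord_eq_zero_of_adapted`): if the letters used on factor `f` all lie on the `x`-axis
(`y = 0`) or all on the `y`-axis (`x = 0`), then `μ = 0`. -/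
theorem oneAxisLaw (D : Design) (h1 : D.A1) (f : Fin 4)
    (hax : (∀ c ∈ D.suppN ++ D.suppP, (c f).y = 0) ∨ (∀ c ∈ D.suppN ++ D.suppP, (c f).x = 0)) : D.mu = 0 := by
  rcases hax with h | h
  · exact collinearBetaLaw D h1 f 0 1 0 (Or.inr one_ne_zero) (fun c hc => by rw [h c hc]; ring)
  · exact collinearBetaLaw D h1 f 1 0 0 (Or.inl one_ne_zero) (fun c hc => by rw [h c hc]; ring)

/-! ## §5 The QUADRANT LAW on the alphabet `A_η` -/

/-- **QUADRANT LAW.** On the height-`η` alphabet (`a + |x| + |y| = η`), if on some factor `f` every letter used lies in ONE closed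
quadrant (`σ·x ≥ 0`, `τ·y ≥ 0` for fixed signs `σ, τ = ±1`), then `μ = 0`: there `a + σx + τy = η` is a non-horizontal plane. -/
theorem quadrantLaw (D : Design) (η : ℤ) (hA : D.OnAlphabet η) (h1 : D.A1) (f : Fin 4) (σ τ : ℤ)
    (hσ : σ = 1 ∨ σ = -1) (hτ : τ = 1 ∨ τ = -1)
    (hquad : ∀ c ∈ D.suppN ++ D.suppP, 0 ≤ σ * (c f).x ∧ 0 ≤ τ * (c f).y) : D.mu = 0 := by
  refine planeLaw D h1 f (-η) 1 σ τ (Or.inl (by rcases hσ with h | h <;> simp [h])) ?_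
  intro c hc
  have hh := (hA c hc f).1
  unfold Letter.height at hh
  obtain ⟨hx, hy⟩ := hquad c hc
  have ex : |(c f).x| = σ * (c f).x := by
    rcases hσ with h | h
    · subst h; rw [one_mul] at hx ⊢; exact abs_of_nonneg hx
    · subst h
      have : (c f).x ≤ 0 := by linarith
      rw [abs_of_nonpos this]; ring
  have ey : |(c f).y| = τ * (c f).y := by
    rcases hτ with h | h
    · subst h; rw [one_mul] at hy ⊢; exact abs_of_nonneg hy
    · subst h
      have : (c f).y ≤ 0 := by linarith
      rw [abs_of_nonpos this]; ring
  rw [ex, ey] at hh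
  linarith

/-! ## §6 Cone geometry: the TAME-CONE LEMMA and the TAME-FACTOR LAW under (A4) -/

/-- A first-quadrant letter position `(x₀, y₀)` is TAME: `x₀, y₀ > 0`, `x₀y₀ ≤ 2x₀ + y₀`, `x₀y₀ ≤ x₀ + 2y₀`
(= `(1,k), (k,1), (2,k), (k,2)` for `k ≤ 4`, and `(3,3)`; every off-axis first-quadrant position of co-level `≤ 6`). -/
def Tame (x₀ y₀ : ℤ) : Prop := 0 < x₀ ∧ 0 < y₀ ∧ x₀ * y₀ ≤ 2 * x₀ + y₀ ∧ x₀ * y₀ ≤ x₀ + 2 * y₀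

/-- Half of the tame-cone lemma: no letter of `A_η` with `x < 0` is amply above a letter `(a₀; x₀, y₀) ∈ A_η` with `x₀, y₀ > 0`,
`y₀ ≥ 0` and `x₀y₀ ≤ 2x₀ + y₀`. -/
theorem x_nonneg_of_ample {η : ℤ} {ℓ₀ ℓ : Letter} (h₀ : ℓ₀.OnAlphabet η) (h : ℓ.OnAlphabet η)
    (hx₀ : 0 < ℓ₀.x) (hy₀ : 0 ≤ ℓ₀.y) (ht : ℓ₀.x * ℓ₀.y ≤ 2 * ℓ₀.x + ℓ₀.y) (hA : AmpleAbove ℓ₀ ℓ) : 0 ≤ ℓ.x := by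
  by_contra hneg'
  have hneg : ℓ.x < 0 := lt_of_not_ge hneg'
  obtain ⟨hlt, hsq⟩ := hA
  have e₀ := h₀.1; have e := h.1
  unfold Letter.height at e₀ e
  rw [abs_of_pos hx₀, abs_of_nonneg hy₀] at e₀
  rw [abs_of_neg hneg] at e
  -- `v = |ℓ.y|`, `(ℓ.y − y₀)² ≥ (v − y₀)²`
  set v := |ℓ.y| with hv
  have hv0 : 0 ≤ v := abs_nonneg _
  have hyy : (v - ℓ₀.y) ^ 2 ≤ (ℓ.y - ℓ₀.y) ^ 2 := by
    rcases abs_choice ℓ.y with hc | hc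
    · rw [hv, hc]
    · rw [hv, hc]; nlinarith [abs_nonneg ℓ.y, hc]
  -- now `a − a₀ = x₀ + y₀ + ℓ.x − v > 0`, `ℓ.x ≤ −1`
  have ha : ℓ.a - ℓ₀.a = ℓ₀.x + ℓ₀.y + ℓ.x - v := by linarith
  rw [ha] at hsq
  have hlt' : 0 < ℓ₀.x + ℓ₀.y + ℓ.x - v := by linarith
  have hx1 : ℓ.x ≤ -1 := by omega
  have key : (ℓ.x - ℓ₀.x) ^ 2 + (v - ℓ₀.y) ^ 2 < (ℓ₀.x + ℓ₀.y + ℓ.x - v) ^ 2 := lt_of_le_of_lt (by linarith) hsq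
  -- the quadratic terms cancel: `0 < G := x₀y₀ + 2x₀X + y₀X − x₀v − Xv`
  have G : 0 < ℓ₀.x * ℓ₀.y + 2 * ℓ₀.x * ℓ.x + ℓ₀.y * ℓ.x - ℓ₀.x * v - ℓ.x * v := by nlinarith [key]
  -- case split on `u = −ℓ.x ≤ x₀` or `> x₀`
  rcases le_or_gt (-ℓ.x) ℓ₀.x with hu | hu
  · nlinarith [mul_nonneg hv0 (by linarith : (0:ℤ) ≤ ℓ₀.x + ℓ.x),
      mul_nonneg (by linarith : (0:ℤ) ≤ -ℓ.x - 1) (by linarith : (0:ℤ) ≤ 2 * ℓ₀.x + ℓ₀.y)]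
  · nlinarith [mul_nonneg (by linarith : (0:ℤ) ≤ -ℓ.x - ℓ₀.x) hlt'.le, mul_pos hx₀ hx₀, sq_nonneg (ℓ.x + ℓ₀.x),
      mul_nonneg (by linarith : (0:ℤ) ≤ -ℓ.x - 1) (by linarith : (0:ℤ) ≤ 2 * ℓ₀.x + ℓ₀.y)]

/-- The mirror half: no letter with `y < 0` is amply above `(a₀; x₀, y₀)` with `x₀ ≥ 0`, `y₀ > 0`, `x₀y₀ ≤ x₀ + 2y₀`. -/
theorem y_nonneg_of_ample {η : ℤ} {ℓ₀ ℓ : Letter} (h₀ : ℓ₀.OnAlphabet η) (h : ℓ.OnAlphabet η)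
    (hx₀ : 0 ≤ ℓ₀.x) (hy₀ : 0 < ℓ₀.y) (ht : ℓ₀.x * ℓ₀.y ≤ ℓ₀.x + 2 * ℓ₀.y) (hA : AmpleAbove ℓ₀ ℓ) : 0 ≤ ℓ.y := by
  -- swap the roles of `x` and `y`
  let sw : Letter → Letter := fun m => ⟨m.a, m.y, m.x⟩
  have hsw : ∀ m : Letter, m.OnAlphabet η → (sw m).OnAlphabet η := by
    intro m hm; refine ⟨?_, hm.2⟩; have := hm.1; unfold Letter.height at this ⊢; simp [sw]; linarith
  have hA' : AmpleAbove (sw ℓ₀) (sw ℓ) := by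
    obtain ⟨h1, h2⟩ := hA; refine ⟨h1, ?_⟩; simp [sw]; linarith
  have := x_nonneg_of_ample (hsw ℓ₀ h₀) (hsw ℓ h) (by simpa [sw] using hy₀) (by simpa [sw] using hx₀)
    (by simp [sw]; linarith) hA'
  simpa [sw] using this

/-- **TAME-CONE LEMMA.** Every letter of `A_η` amply above a tame first-quadrant letter of `A_η` lies in the closed first quadrant. -/
theorem fstQuadrant_of_ample_tame {η : ℤ} {ℓ₀ ℓ : Letter} (h₀ : ℓ₀.OnAlphabet η) (h : ℓ.OnAlphabet η)
    (ht : Tame ℓ₀.x ℓ₀.y) (hA : AmpleAbove ℓ₀ ℓ) : 0 ≤ ℓ.x ∧ 0 ≤ ℓ.y :=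
  ⟨x_nonneg_of_ample h₀ h ht.1 (le_of_lt ht.2.1) ht.2.2.1 hA,
   y_nonneg_of_ample h₀ h (le_of_lt ht.1) ht.2.1 ht.2.2.2 hA⟩

/-- Sharpness witness of the criterion: `(η−1; −1, 0)` IS amply above `(a₀; x₀, y₀)` as soon as `x₀y₀ > 2x₀ + y₀` (e.g. `(3,4)`,
`(4,4)`, `(2,5)`), so the tame range is exactly where the cone stays in the quadrant along `x`. -/
theorem crossing_witness (η x₀ y₀ : ℤ) (hx₀ : 0 < x₀) (hy₀ : 0 < y₀) (hbig : 2 * x₀ + y₀ < x₀ * y₀) :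
    AmpleAbove ⟨η - x₀ - y₀, x₀, y₀⟩ ⟨η - 1, -1, 0⟩ := by
  refine ⟨by simp; nlinarith, ?_⟩
  simp
  nlinarith

/-- **TAME-FACTOR LAW.** An (A1) ∧ (A4) design on the alphabet `A_η` whose P-cells all carry, on some factor `f`, a TAME
first-quadrant letter has `μ = 0`: by (A4) every N-letter on `f` is amply above a P-letter on `f`, hence in the closed first
quadrant (tame-cone lemma), and the QUADRANT LAW applies. All signs of `μ`, all masses, every `η`, no budget. -/
theorem tameFactorLaw (D : Design) (η : ℤ) (hA : D.OnAlphabet η) (h1 : D.A1) (h4 : D.A4) (f : Fin 4)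
    (htame : ∀ x ∈ D.suppP, Tame (x f).x (x f).y) : D.mu = 0 := by
  refine quadrantLaw D η hA h1 f 1 1 (Or.inl rfl) (Or.inl rfl) ?_
  intro c hc
  rw [one_mul, one_mul]
  rcases List.mem_append.1 hc with hN | hP
  · obtain ⟨x, hx, hlive⟩ := h4.2 c hN
    have hxA : (x f).OnAlphabet η := hA x (List.mem_append.2 (Or.inr hx)) f
    have hcA : (c f).OnAlphabet η := hA c hc f
    exact fstQuadrant_of_ample_tame hxA hcA (htame x hx) (hlive f)
  · have ht := htame c hP
    exact ⟨le_of_lt ht.1, le_of_lt ht.2.1⟩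

/-- The tame positions include EVERY off-axis first-quadrant position of co-level `≤ 6`. -/
theorem tame_of_colevel_le_six (x₀ y₀ : ℤ) (hx : 0 < x₀) (hy : 0 < y₀) (hc : x₀ + y₀ ≤ 6) : Tame x₀ y₀ := by
  have hx5 : x₀ ≤ 5 := by omega
  refine ⟨hx, hy, ?_⟩
  interval_cases x₀ <;> omega

/-- … and `(3,3)`, `(2,4)`, `(4,2)`, `(1,k)`, `(k,1)` in general. -/
theorem tame_examples : Tame 3 3 ∧ Tame 2 4 ∧ Tame 4 2 ∧ (∀ k : ℤ, 0 < k → Tame 1 k ∧ Tame k 1) := by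
  refine ⟨by unfold Tame; omega, by unfold Tame; omega, by unfold Tame; omega, fun k hk => ⟨?_, ?_⟩⟩ <;>
    (unfold Tame; refine ⟨by omega, by omega, by nlinarith, by nlinarith⟩)

/-- … while the co-level-7 positions `(2,5)`, `(3,4)` and the deeper `(4,4)`, `(4,5)` (the P-letters of the rational witnesses
C644 ∕ C545 of MEMO-13) are NOT tame. -/
theorem not_tame_examples : ¬ Tame 2 5 ∧ ¬ Tame 3 4 ∧ ¬ Tame 4 4 ∧ ¬ Tame 4 5 := by
  unfold Tame; omega

/-! ## §7 All four quadrants: reflections, and the RING-SIX MONOCHROME LAW -/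

/-- The reflection `(a; x, y) ↦ (a; σx, τy)`, `σ, τ = ±1`. -/
def flipL (σ τ : ℤ) (ℓ : Letter) : Letter := ⟨ℓ.a, σ * ℓ.x, τ * ℓ.y⟩

theorem abs_sign_mul {σ : ℤ} (hσ : σ = 1 ∨ σ = -1) (u : ℤ) : |σ * u| = |u| := by
  rcases hσ with h | h <;> subst h <;> simp

theorem onAlphabet_flip {η σ τ : ℤ} (hσ : σ = 1 ∨ σ = -1) (hτ : τ = 1 ∨ τ = -1) {ℓ : Letter}
    (h : ℓ.OnAlphabet η) : (flipL σ τ ℓ).OnAlphabet η := by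
  refine ⟨?_, h.2⟩
  have := h.1
  unfold Letter.height at this ⊢
  simp only [flipL, abs_sign_mul hσ, abs_sign_mul hτ]
  exact this

theorem sq_sign_mul_sub {σ : ℤ} (hσ : σ = 1 ∨ σ = -1) (u v : ℤ) : (σ * u - σ * v) ^ 2 = (u - v) ^ 2 := by
  rcases hσ with h | h <;> subst h <;> ring

theorem ampleAbove_flip {σ τ : ℤ} (hσ : σ = 1 ∨ σ = -1) (hτ : τ = 1 ∨ τ = -1) {ℓ₀ ℓ : Letter}
    (h : AmpleAbove ℓ₀ ℓ) : AmpleAbove (flipL σ τ ℓ₀) (flipL σ τ ℓ) := by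
  obtain ⟨h1, h2⟩ := h
  refine ⟨h1, ?_⟩
  simp only [flipL, sq_sign_mul_sub hσ, sq_sign_mul_sub hτ]
  exact h2

/-- TAME-CONE LEMMA in the quadrant `(σ, τ)`: every letter of `A_η` amply above a letter that is tame in that quadrant stays in
that (closed) quadrant. -/
theorem quadrant_of_ample_tame {η σ τ : ℤ} (hσ : σ = 1 ∨ σ = -1) (hτ : τ = 1 ∨ τ = -1) {ℓ₀ ℓ : Letter}
    (h₀ : ℓ₀.OnAlphabet η) (h : ℓ.OnAlphabet η) (ht : Tame (σ * ℓ₀.x) (τ * ℓ₀.y)) (hA : AmpleAbove ℓ₀ ℓ) :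
    0 ≤ σ * ℓ.x ∧ 0 ≤ τ * ℓ.y :=
  fstQuadrant_of_ample_tame (onAlphabet_flip hσ hτ h₀) (onAlphabet_flip hσ hτ h) ht (ampleAbove_flip hσ hτ hA)

/-- TAME-FACTOR LAW in the quadrant `(σ, τ)`. -/
theorem tameFactorLaw' (D : Design) (η : ℤ) (hA : D.OnAlphabet η) (h1 : D.A1) (h4 : D.A4) (f : Fin 4) (σ τ : ℤ)
    (hσ : σ = 1 ∨ σ = -1) (hτ : τ = 1 ∨ τ = -1)
    (htame : ∀ x ∈ D.suppP, Tame (σ * (x f).x) (τ * (x f).y)) : D.mu = 0 := by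
  refine quadrantLaw D η hA h1 f σ τ hσ hτ ?_
  intro c hc
  rcases List.mem_append.1 hc with hN | hP
  · obtain ⟨x, hx, hlive⟩ := h4.2 c hN
    exact quadrant_of_ample_tame hσ hτ (hA x (List.mem_append.2 (Or.inr hx)) f) (hA c hc f) (htame x hx) (hlive f)
  · have ht := htame c hP
    exact ⟨le_of_lt ht.1, le_of_lt ht.2.1⟩

/-- **RING-SIX MONOCHROME LAW.** An (A1) ∧ (A4) design on `A_η` whose P-letters on some factor `f` all lie in ONE open quadrant
and have co-level `≤ 6` has `μ = 0` (budget-free, sign-free, every height; compare the kernel certificates `RingFourEmpty` ∕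
`RingFiveEmpty`, which need the copy budget but allow P-letters spread over quadrants). Contrapositive: a `μ ≠ 0` design with
P-letters of co-level `≤ 6` is POLYCHROME — its P-letters meet at least two open quadrants on every factor. -/
theorem ringSix_monochromeLaw (D : Design) (η : ℤ) (hA : D.OnAlphabet η) (h1 : D.A1) (h4 : D.A4) (f : Fin 4) (σ τ : ℤ)
    (hσ : σ = 1 ∨ σ = -1) (hτ : τ = 1 ∨ τ = -1)
    (hP : ∀ x ∈ D.suppP, 0 < σ * (x f).x ∧ 0 < τ * (x f).y ∧ (x f).colevel ≤ 6) : D.mu = 0 := by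
  refine tameFactorLaw' D η hA h1 h4 f σ τ hσ hτ (fun x hx => ?_)
  obtain ⟨hx1, hx2, hx3⟩ := hP x hx
  refine tame_of_colevel_le_six _ _ hx1 hx2 ?_
  unfold Letter.colevel at hx3
  have ex : |σ * (x f).x| = |(x f).x| := abs_sign_mul hσ _
  have ey : |τ * (x f).y| = |(x f).y| := abs_sign_mul hτ _
  rw [abs_of_pos hx1] at ex
  rw [abs_of_pos hx2] at ey
  linarith

/-- First-quadrant instance (`σ = τ = 1`). -/
theorem fstQuadrant_colevel_six_law (D : Design) (η : ℤ) (hA : D.OnAlphabet η) (h1 : D.A1) (h4 : D.A4) (f : Fin 4)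
    (hP : ∀ x ∈ D.suppP, 0 < (x f).x ∧ 0 < (x f).y ∧ (x f).colevel ≤ 6) : D.mu = 0 :=
  ringSix_monochromeLaw D η hA h1 h4 f 1 1 (Or.inl rfl) (Or.inl rfl) (fun x hx => by simpa using hP x hx)

/-! ## §8 SYNTHESIS TRIPLES and SIGNED SEEDS: no sign-blind law suffices (`¬ AllRigid h 97`, every `h ≥ 4`) -/

section Synthesis

variable (L : Fin 3 → Letter) (U : Fin 3 → GaussianInt) (ν : ℤ)

/-- `(L, U, ν)` is a SYNTHESIS TRIPLE: three letters and three Gaussian weights with `Σ_j U_j · coef s (L j) = ν·[s = e]` for all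
five symbols. (Exists iff the three letters have equal level and equal `|β|`: then `(1, a, β, n)` has rank 2 on them while
`β̄ = |β|²/β` is not affine in `β`; e.g. three of the four hub neighbours `(h−1; ±1, 0), (h−1; 0, ±1)`, or three letters of a
Pythagorean ring.) -/
def Synth : Prop := ∀ s : Sym, ∑ j : Fin 3, U j * s.coef (L j) = if s = Sym.e then (ν : GaussianInt) else 0

/-- The 81 cells `{L₀, L₁, L₂}⁴`. -/
def triCell (g : Fin 4 → Fin 3) : Cell := fun f => L (g f)

/-- … as a list. -/
noncomputable def triList : List Cell := (Finset.univ : Finset (Fin 4 → Fin 3)).toList.map (triCell L)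

theorem mem_triList {c : Cell} : c ∈ triList L ↔ ∃ g, triCell L g = c := by simp [triList]

/-- **SIGNED-SEED IDENTITY**: for a synthesis triple the complex-weighted combination `Σ_g (Π_f U_{g f})·ch(triCell g)` has class
tensor `ν⁴·δ_eeee` — every mixed word and every e-free word vanishes identically ((A1)-clean in the strongest sense), `μ = ν⁴`. -/
theorem synth_identity (hS : Synth L U ν) (w : Word) :
    ∑ g : Fin 4 → Fin 3, (∏ f, U (g f)) * cellCoef (triCell L g) w =
      if w = Word.eeee then (ν : GaussianInt) ^ 4 else 0 := by
  have h1 : ∑ g : Fin 4 → Fin 3, (∏ f, U (g f)) * cellCoef (triCell L g) w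
      = ∏ f : Fin 4, ∑ j : Fin 3, U j * (w f).coef (L j) := by
    rw [Fintype.prod_sum (fun f j => U j * (w f).coef (L j))]
    refine Finset.sum_congr rfl (fun g _ => ?_)
    simp only [cellCoef, triCell]
    rw [← Finset.prod_mul_distrib]
  rw [h1]
  have hS' : ∀ s : Sym, ∑ j : Fin 3, U j * s.coef (L j) = if s = Sym.e then (ν : GaussianInt) else 0 := hS
  simp_rw [hS']
  by_cases hw : w = Word.eeee
  · subst hw
    simp only [Word.eeee, if_true, Finset.prod_const, Finset.card_univ, Fintype.card_fin]
  · rw [if_neg hw]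
    obtain ⟨f, hf⟩ := Function.ne_iff.1 hw
    have hf' : w f ≠ Sym.e := hf
    exact Finset.prod_eq_zero (Finset.mem_univ f) (if_neg hf')

/-- The 81-cell support of a synthesis triple with `ν ≠ 0` is NOT μ-rigid. -/
theorem not_rigid_triList (hS : Synth L U ν) (hν : ν ≠ 0) : ¬ Rigid (triList L) := by
  rintro ⟨lam, hne, -, -, hv⟩
  have hcell : ∀ g : Fin 4 → Fin 3, ∑ w : Word, lam w * cellCoef (triCell L g) w = 0 :=
    fun g => hv _ ((mem_triList L).2 ⟨g, rfl⟩)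
  have h0 : ∑ g : Fin 4 → Fin 3, (∏ f, U (g f)) * ∑ w : Word, lam w * cellCoef (triCell L g) w = 0 :=
    Finset.sum_eq_zero (fun g _ => by rw [hcell g, mul_zero])
  have hswap : ∑ g : Fin 4 → Fin 3, (∏ f, U (g f)) * ∑ w : Word, lam w * cellCoef (triCell L g) w
      = ∑ w : Word, lam w * ∑ g : Fin 4 → Fin 3, (∏ f, U (g f)) * cellCoef (triCell L g) w := by
    simp_rw [Finset.mul_sum]
    rw [Finset.sum_comm]
    refine Finset.sum_congr rfl (fun w _ => Finset.sum_congr rfl (fun g _ => by ring))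
  rw [hswap] at h0
  simp_rw [synth_identity L U ν hS, mul_ite, mul_zero, Finset.sum_ite_eq', Finset.mem_univ, if_true] at h0
  have hcast : (ν : GaussianInt) ^ 4 = ((ν ^ 4 : ℤ) : GaussianInt) := by push_cast; rfl
  have hre4 : ((ν : GaussianInt) ^ 4).re = ν ^ 4 := by rw [hcast]; exact Zsqrtd.re_intCast _
  have him4 : ((ν : GaussianInt) ^ 4).im = 0 := by rw [hcast]; exact Zsqrtd.im_intCast _
  have hν4 : ν ^ 4 ≠ 0 := pow_ne_zero 4 hν
  have hre := congrArg Zsqrtd.re h0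
  have him := congrArg Zsqrtd.im h0
  simp only [Zsqrtd.re_mul, Zsqrtd.im_mul, hre4, him4, mul_zero, add_zero, zero_add, Zsqrtd.re_zero,
    Zsqrtd.im_zero, mul_eq_zero, hν4, or_false] at hre him
  exact hne (Zsqrtd.ext_iff.2 ⟨by simpa using hre, by simpa using him⟩)

variable (C : Fin 2 → Letter)

/-- Companion P-cells `{C₀, C₁}⁴` (16 cells). -/
def compCell (g : Fin 4 → Fin 2) : Cell := fun f => C (g f)

/-- … as a list. -/
noncomputable def compList : List Cell := (Finset.univ : Finset (Fin 4 → Fin 2)).toList.map (compCell C)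

theorem mem_compList {c : Cell} : c ∈ compList C ↔ ∃ g, compCell C g = c := by simp [compList]

/-- The PADDED design: N = the 81 triple cells, P = the 16 companion cells, all multiplicities 1. -/
noncomputable def padDesign : Design := ⟨(triList L).map fun c => (c, 1), (compList C).map fun c => (c, 1)⟩

theorem padDesign_suppN : (padDesign L C).suppN = triList L := by
  unfold Design.suppN padDesign
  simp [List.filter_map, Function.comp_def]

theorem padDesign_suppP : (padDesign L C).suppP = compList C := by
  unfold Design.suppP padDesign
  simp [List.filter_map, Function.comp_def]

theorem padDesign_onAlphabet (h : ℤ) (hL : ∀ j, (L j).OnAlphabet h) (hC : ∀ k, (C k).OnAlphabet h) :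
    (padDesign L C).OnAlphabet h := by
  intro c hc f
  rw [padDesign_suppN, padDesign_suppP] at hc
  rcases List.mem_append.1 hc with hN | hP
  · obtain ⟨g, rfl⟩ := (mem_triList L).1 hN
    exact hL (g f)
  · obtain ⟨g, rfl⟩ := (mem_compList C).1 hP
    exact hC (g f)

/-- (A4) for the padded design from a LIFT `Fin 2 → Fin 3` (each companion letter amply below some triple letter) and a DROP
`Fin 3 → Fin 2` (each triple letter amply above some companion letter). -/
theorem padDesign_A4 (lift : Fin 2 → Fin 3) (drop : Fin 3 → Fin 2) (hlift : ∀ k, AmpleAbove (C k) (L (lift k)))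
    (hdrop : ∀ j, AmpleAbove (C (drop j)) (L j)) : (padDesign L C).A4 := by
  refine ⟨fun x hx => ?_, fun y hy => ?_⟩
  · rw [padDesign_suppP] at hx
    obtain ⟨g, rfl⟩ := (mem_compList C).1 hx
    refine ⟨triCell L (fun f => lift (g f)), ?_, fun f => hlift (g f)⟩
    rw [padDesign_suppN]; exact (mem_triList L).2 ⟨_, rfl⟩
  · rw [padDesign_suppN] at hy
    obtain ⟨g, rfl⟩ := (mem_triList L).1 hy
    refine ⟨compCell C (fun f => drop (g f)), ?_, fun f => hdrop (g f)⟩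
    rw [padDesign_suppP]; exact (mem_compList C).2 ⟨_, rfl⟩

theorem padDesign_length : ((padDesign L C).suppN ++ (padDesign L C).suppP).length = 97 := by
  rw [padDesign_suppN, padDesign_suppP, List.length_append]
  simp [triList, compList, Finset.length_toList, Finset.card_univ, Fintype.card_fin]

/-- **SIGNED-SEED REFUTATION OF RIGID(h, 97)**: a synthesis triple on `A_h` with companions below gives an (A4)-admissible
support of 97 cells that is not μ-rigid. -/
theorem not_allRigid_of_synth (h : ℤ) (hS : Synth L U ν) (hν : ν ≠ 0) (hL : ∀ j, (L j).OnAlphabet h)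
    (hC : ∀ k, (C k).OnAlphabet h) (lift : Fin 2 → Fin 3) (drop : Fin 3 → Fin 2)
    (hlift : ∀ k, AmpleAbove (C k) (L (lift k))) (hdrop : ∀ j, AmpleAbove (C (drop j)) (L j)) : ¬ AllRigid h 97 := by
  intro H
  have hR := H (padDesign L C) (padDesign_onAlphabet L C h hL hC) (padDesign_A4 L C lift drop hlift hdrop)
    (le_of_eq (padDesign_length L C))
  refine not_rigid_triList L U ν hS hν (rigid_mono (fun c hc => ?_) hR)
  rw [padDesign_suppN, padDesign_suppP]
  exact List.mem_append_left _ hc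

end Synthesis

/-! ### §8a The PYTHAGOREAN signed seed (level 7, ring `|β| = 5`, co-level 7; companions at co-level 10) -/

/-- `ℓ₀ = (7;3,4)`, `ℓ₁ = (7;4,3)`, `ℓ₂ = (7;−3,4)`. -/
def pyL : Fin 3 → Letter := ![⟨7, 3, 4⟩, ⟨7, 4, 3⟩, ⟨7, -3, 4⟩]

/-- `12·U = (1+7i, −6i, −1−i)`. -/
def pyU : Fin 3 → GaussianInt := ![⟨1, 7⟩, ⟨0, -6⟩, ⟨-1, -1⟩]

theorem py_synth : Synth pyL pyU 12 := by
  intro s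
  rw [Fin.sum_univ_three]
  cases s <;> (rw [Zsqrtd.ext_iff]; simp [pyU, pyL, Sym.coef, Letter.beta, Letter.selfInt, Letter.bnorm,
    Zsqrtd.re_mul, Zsqrtd.im_mul])

/-- Companions `A = (4;5,5)` (amply below `ℓ₀, ℓ₁`), `B = (4;−5,5)` (below `ℓ₂`). -/
def pyComp : Fin 2 → Letter := ![⟨4, 5, 5⟩, ⟨4, -5, 5⟩]

theorem not_allRigid_14_97 : ¬ AllRigid 14 97 := by
  refine not_allRigid_of_synth pyL pyU 12 pyComp 14 py_synth (by norm_num) (fun j => ?_) (fun k => ?_) ![0, 2] ![0, 0, 1]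
    (fun k => ?_) (fun j => ?_)
  · fin_cases j <;> (simp [pyL, Letter.OnAlphabet, Letter.height])
  · fin_cases k <;> (simp [pyComp, Letter.OnAlphabet, Letter.height])
  · fin_cases k <;> (simp [pyComp, pyL, AmpleAbove])
  · fin_cases j <;> (simp [pyComp, pyL, AmpleAbove])

/-- Hence the sign-blind S⁺ RIGID(14, 199) is false; the hypothesis of `nonex_of_allRigid` is not available. -/
theorem not_allRigid_14_199 : ¬ AllRigid 14 199 := fun H => not_allRigid_14_97 (allRigid_mono (by norm_num) H)

/-! ### §8b The HUB-NEIGHBOUR signed seed (co-levels 1 and 4 only, every height `h ≥ 4`) -/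

/-- Three of the four hub neighbours: `(h−1; 1, 0), (h−1; 0, 1), (h−1; −1, 0)` (`|β| = 1`). -/
def hubL (h : ℤ) : Fin 3 → Letter := ![⟨h - 1, 1, 0⟩, ⟨h - 1, 0, 1⟩, ⟨h - 1, -1, 0⟩]

/-- `4·U = (1−i, 2i, −1−i)`. -/
def hubU : Fin 3 → GaussianInt := ![⟨1, -1⟩, ⟨0, 2⟩, ⟨-1, -1⟩]

theorem hub_synth (h : ℤ) : Synth (hubL h) hubU 4 := by
  intro s
  rw [Fin.sum_univ_three]
  cases s <;> (rw [Zsqrtd.ext_iff]; constructor <;>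
    (simp [hubU, hubL, Sym.coef, Letter.beta, Letter.selfInt, Letter.bnorm, Zsqrtd.re_mul, Zsqrtd.im_mul]; try ring))

/-- Companions `(h−4; 2, 2)` (amply below `(h−1;1,0)` and `(h−1;0,1)`: `Δa = 3`, `|Δβ|² = 5 < 9`) and `(h−4; −2, 2)` (below
`(h−1;−1,0)` and `(h−1;0,1)`). -/
def hubComp (h : ℤ) : Fin 2 → Letter := ![⟨h - 4, 2, 2⟩, ⟨h - 4, -2, 2⟩]

/-- **`¬ RIGID(h, 97)` INSIDE RINGS ≤ 4, AT EVERY HEIGHT `h ≥ 4`.** (Rings `≤ 5` ARE empty for actual designs at `B = 199` —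
`RingFourEmpty`, `RingFiveEmpty` — by budgeted positivity certificates: the gap between the two is exactly what sign-blind test
forms cannot see.) -/
theorem not_allRigid_hub (h : ℤ) (hh : 4 ≤ h) : ¬ AllRigid h 97 := by
  refine not_allRigid_of_synth (hubL h) hubU 4 (hubComp h) h (hub_synth h) (by norm_num) (fun j => ?_) (fun k => ?_)
    ![0, 2] ![0, 0, 1] (fun k => ?_) (fun j => ?_)
  · fin_cases j <;> (simp [hubL, Letter.OnAlphabet, Letter.height]; try omega)
  · fin_cases k <;> (simp [hubComp, Letter.OnAlphabet, Letter.height]; omega)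
  · fin_cases k <;> (simp [hubComp, hubL, AmpleAbove])
  · fin_cases j <;> (simp [hubComp, hubL, AmpleAbove])

theorem not_allRigid_199 (h : ℤ) (hh : 4 ≤ h) : ¬ AllRigid h 199 := fun H => not_allRigid_hub h hh (allRigid_mono (by norm_num) H)

end Summit.HodgeConjecture.HodgeConjecture.Cruxes.BlochSeedDiscOne.CoveringLaw
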